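import Summits.Ventures.PercRepro.RankLevelSetRuleQRhat

/-!
# PercRepro — RULE Q AT THE TIGHT LAYER, CELL BY CELL (night-1, gen 14; dossier §23.8–§23.9)

The landed chain `RhatIneq ⇒ RuleQUp ⇒ UP-Hall` (RankLevelSetRuleQRhat) uses the arithmetic inequality (R̂) only at the
cell's own `(q, k)`: `hR q k m hq hk hm` for `m = #P ≤ q`. This module isolates that:
* `RhatCell q k` — the per-cell hypothesis `∀ m ≤ q, Φ(q+k, q) ≤ R̂(q, k, m)` (a closed statement about finitely many
  rationals, evaluable in the kernel);
* `rhatCell_of_rhatIneq` — the global (R̂) implies every cell;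
* **`ruleQUp_of_ncard_eq_of_rhatCell`** — `RhatCell q k ⇒ RuleQUp M (q+k) q` at the tight layer `#E = (q+k) + q`;
* **`hallUp_of_ncard_eq_of_rhatCell`** — `RhatCell q k` ⇒ the UP-Hall condition of C-044 at the tight layer of the cell
  `(q+k, q)` for every family `𝒜` of members (via `hallUp_of_ruleQ`);
* `sum_Ioo_nat` — the `Finset.Ioo`-sums of `phiK` / `rhat` as `Finset.range`-sums (so that `norm_num` evaluates them).
The cells themselves are discharged in RankLevelSetRuleQCellEval*.lean.  Axioms: standard.
-/

namespace PercRepro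

open Set Matroid Finset

variable {α : Type} (M : Matroid α) [M.Finite]

/-- **The per-cell arithmetic hypothesis**: `Φ(q+k, q) ≤ R̂(q, k, m)` for every `m ≤ q` (the only instances of (R̂) that
the cell `(q+k, q)` needs). -/
def RhatCell (q k : ℕ) : Prop := ∀ m ≤ q, phiK (q + k) q ≤ rhat q k m

/-- The global inequality (R̂) gives every cell. -/
theorem rhatCell_of_rhatIneq (hR : RhatIneq) {q k : ℕ} (hq : 1 ≤ q) (hk : 2 ≤ k) : RhatCell q k :=
  fun m hm => hR q k m hq hk hm

/-- **Rule Q at the tight layer of the cell `(q + k, q)`, modulo its own cell inequality**: every member receives at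
least `Φ(q+k, q)`. -/
theorem ruleQUp_of_ncard_eq_of_rhatCell {q k : ℕ} (hR : RhatCell q k) (hE : M.E.ncard = (q + k) + q) :
    RuleQUp M (q + k) q := by
  intro Z hZ
  exact (hR _ (ncard_flatPart_le M hE hZ)).trans (rhat_le_ruleQRecv M hE hZ)

/-- **The UP form of C-044 at the tight layer of the cell `(q + k, q)`, modulo its own cell inequality**: `#E = (q+k) + q`
and `RhatCell q k` ⇒ every family `𝒜` of members has at least `Φ(q+k, q)·#𝒜` UP-neighbours. -/
theorem hallUp_of_ncard_eq_of_rhatCell {q k : ℕ} (hR : RhatCell q k) (hE : M.E.ncard = (q + k) + q)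
    (𝒜 : Set (Set α)) (h𝒜 : 𝒜 ⊆ cellMembers M (q + k) q) :
    phiK (q + k) q * (𝒜.ncard : ℚ) ≤ ((upNbhd M (q + k) q 𝒜).ncard : ℚ) :=
  hallUp_of_ruleQ M (q + k) q (ruleQUp_of_ncard_eq_of_rhatCell M hR hE) 𝒜 h𝒜

/-- A `Finset.Ioo`-sum over naturals as a `Finset.range`-sum (the shape `norm_num` evaluates). -/
lemma sum_Ioo_nat (a b : ℕ) (f : ℕ → ℚ) :
    ∑ u ∈ Finset.Ioo a b, f u = ∑ u ∈ Finset.range (b - (a + 1)), f (a + 1 + u) := by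
  rw [← Finset.Ico_succ_left_eq_Ioo, Order.succ_eq_add_one, Finset.sum_Ico_eq_sum_range]

end PercRepro
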